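import Summits.FinalStateConjecture.FinalStateConjecture.Theorems.EIHFluxBalanceInertialRecessionLorentz
import Literature.Geometry.Lorentzian.KerrWaveDecay

/-!
# Route EIHFluxBalance — `InertialRecession`: straight sublinear tubes from Cesàro velocities

Helper file for the crux `stmt-FinalStateConjecture-10166`
(`Summit.FinalStateConjecture.FinalStateConjecture.Theses.EIHFluxBalance.InertialRecession`).

The flat domain of a `FinalStateDecomposition` must CONTAIN the late half-space minus the tubes
`{r_{aᵢ}(Λᵢ⁻¹(x − cᵢ)) ≤ ρᵢ(x⁰)}` of SUBLINEAR radii `ρᵢ = o(t)` around the straight world-lines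
of the constant motions `(Λᵢ, cᵢ)` (fields `setOf_lt_excision_subset_flatDomain`,
`tendsto_excision_div`), while the flat chart only converges on hole-following domains
`{∀ i, R′(x⁰) < ‖x̲ − ξᵢ(x⁰)‖}` (file `…FlatChart`). The two fit together iff every lab ball of
radius `R′(t)` about the ACTUAL centre `ξᵢ(t)` lies in the straight tube at time `t`, and this file
proves the quantitative form of that containment for an arbitrary constant motion `(Λ, c)` with lab
velocity `u = (Λe₀)~/(Λe₀)⁰`:

* `radius_poincareInv_le_of_near_centre` : if `‖x̲ − ξ(x⁰)‖ ≤ R′(x⁰)` then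
  `r_a(Λ⁻¹(x − c)) ≤ (1 + 3|(Λe₀)⁰|)·(R′(x⁰) + ‖ξ(x⁰) − (c̲ + (x⁰ − c⁰)u)‖)` — the painted radius
  about the straight line is controlled by the lab distance to the line, because `Λ⁻¹` maps the
  line's direction `Λe₀` to the time axis (no spatial component) and has operator norm
  `≤ 1 + 3γ` (`norm_lorentz_symm_le'`);
* `tendsto_drift_div_of_cesaro` : a Cesàro velocity `ξ(t)/t → u` makes the drift from the
  straight line sublinear, `‖ξ(t) − (c̲ + (t − c⁰)u)‖ / t → 0`;
* `tendsto_excisionRadius_div` : hence the excision radius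
  `ρ(t) = (1 + 3|(Λe₀)⁰|)(R′(t) + drift(t))` is sublinear whenever `R′(t)/t → 0`.

So ONLY the Cesàro velocity of each centre is load-bearing for the flat-domain clauses (card
`cesaro-velocities-suffice`, Cruxes/InertialRecession/Ideas) — no convergence of instantaneous
velocities, boosts or spin axes.
-/

noncomputable section

open Literature.Geometry.Lorentzian Set Filter Function
open scoped Topology

namespace Summit.FinalStateConjecture.FinalStateConjecture.Theorems

/-- `Λ⁻¹(Λ e₀) = e₀`: the inverse motion maps the world-line direction to the time axis
(bookkeeping). [folklore] -/
theorem lorentz_symm_apply_apply_basisVector (Λ : lorentzGroup) :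
    (Λ : E4 ≃L[ℝ] E4).symm ((Λ : E4 ≃L[ℝ] E4) (E4.basisVector 0)) = E4.basisVector 0 :=
  (Λ : E4 ≃L[ℝ] E4).symm_apply_apply _

/-- The time axis has no spatial part: `(e₀)~ = 0` (bookkeeping). [folklore] -/
theorem spatial_basisVector_zero : E4.spatial (E4.basisVector 0) = 0 := by
  ext i
  simp [E4.spatial_apply, Fin.succ_ne_zero]

/-- **Painted radius about a straight world-line versus lab distance to the line.** For a constant
motion `(Λ, c)` with Lorentz factor `γ = (Λe₀)⁰` and lab velocity `u = (Λe₀)~/γ`, and any lab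
point `x`: `r_a(Λ⁻¹(x − c)) ≤ (1 + 3|γ|)·‖x̲ − (c̲ + (x⁰ − c⁰)u)‖` — decompose
`x − c = (x − p) + s·Λe₀` with `p` the point of the line at lab time `x⁰`; `Λ⁻¹` kills the spatial
part of the second term, `r ≤ ‖·~‖` (`Kerr.radius_le_spatialNorm`), and `‖Λ⁻¹‖ ≤ 1 + 3|γ|`.
[folklore] -/
theorem radius_poincareInv_le_dist_line (Λ : lorentzGroup) (c x : E4) (a : ℝ) :
    Kerr.radius a (poincareInv Λ c x) ≤ (1 + 3 * |((Λ : E4 ≃L[ℝ] E4) (E4.basisVector 0)) 0|) *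
      ‖E4.spatial x - (E4.spatial c + (x 0 - c 0) •
        ((((Λ : E4 ≃L[ℝ] E4) (E4.basisVector 0)) 0)⁻¹ •
          E4.spatial ((Λ : E4 ≃L[ℝ] E4) (E4.basisVector 0))))‖ := by
  set L : E4 ≃L[ℝ] E4 := (Λ : E4 ≃L[ℝ] E4) with hL
  set e : E4 := L (E4.basisVector 0) with he
  set γ : ℝ := e 0 with hγ
  have hγ1 : 1 ≤ |γ| := one_le_abs_lorentz_apply_zero Λ
  have hγ0 : γ ≠ 0 := fun h ↦ by rw [h, abs_zero] at hγ1; exact absurd hγ1 (by norm_num)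
  set s : ℝ := (x 0 - c 0) / γ with hs
  set p : E4 := c + s • e with hp
  -- `p` is on the slab through `x`
  have hp0 : p 0 = x 0 := by
    have h1 : p 0 = c 0 + s * e 0 := by simp [hp]
    rw [h1, ← hγ, hs, div_mul_cancel₀ _ hγ0, add_sub_cancel]
  -- rest-frame position splits
  have hsplit : poincareInv Λ c x = L.symm (x - p) + s • E4.basisVector 0 := by
    change L.symm (x - c) = _
    have : x - c = (x - p) + s • e := by rw [hp]; abel
    rw [this, map_add, map_smul, he, hL, lorentz_symm_apply_apply_basisVector]
  have hspat : E4.spatial (poincareInv Λ c x) = E4.spatial (L.symm (x - p)) := by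
    rw [hsplit, map_add, map_smul, spatial_basisVector_zero, smul_zero, add_zero]
  -- the lab vector `x - p` is spatial, of norm the lab distance to the line point
  have hxp0 : (x - p) 0 = 0 := by simp [hp0]
  have hxp : ‖x - p‖ = ‖E4.spatial x - (E4.spatial c + (x 0 - c 0) • (γ⁻¹ • E4.spatial e))‖ := by
    rw [norm_eq_spatialNorm_of_apply_zero_eq_zero hxp0, E4.spatialNorm, map_sub]
    congr 1
    simp only [hp, map_add, map_smul, hs, smul_smul]
    congr 2
  calc Kerr.radius a (poincareInv Λ c x) ≤ E4.spatialNorm (poincareInv Λ c x) :=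
        Kerr.radius_le_spatialNorm a _
    _ = ‖E4.spatial (L.symm (x - p))‖ := by rw [E4.spatialNorm, hspat]
    _ ≤ ‖L.symm (x - p)‖ := by
        have h := norm_sq_eq_sq_add_spatialNorm_sq (L.symm (x - p))
        rw [E4.spatialNorm] at h
        nlinarith [norm_nonneg (L.symm (x - p)), norm_nonneg (E4.spatial (L.symm (x - p))),
          sq_nonneg ((L.symm (x - p)) 0)]
    _ ≤ ‖(L.symm : E4 →L[ℝ] E4)‖ * ‖x - p‖ := (L.symm : E4 →L[ℝ] E4).le_opNorm (x - p)
    _ ≤ (1 + 3 * |γ|) * ‖x - p‖ :=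
        mul_le_mul_of_nonneg_right (norm_lorentz_symm_le' Λ) (norm_nonneg _)
    _ = _ := by rw [hxp]

/-- **Balls about the actual centre lie in the straight tube.** If the lab point `x` is within
`R′(x⁰)` of the actual centre `ξ(x⁰)`, its painted radius about the straight line of the constant
motion `(Λ, c)` is at most `(1 + 3|γ|)(R′(x⁰) + drift(x⁰))`, where
`drift(t) = ‖ξ(t) − (c̲ + (t − c⁰)u)‖` is the lab distance of the actual centre from the line
(triangle inequality in `radius_poincareInv_le_dist_line`). Contrapositive = the containment
`{ρ(x⁰) < r} ⊆ {R′(x⁰) < ‖x̲ − ξ(x⁰)‖}` needed for `setOf_lt_excision_subset_flatDomain`. [folklore] -/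
theorem radius_poincareInv_le_of_near_centre' (Λ : lorentzGroup) (c : E4) (a : ℝ) (ξ : ℝ → E3)
    (R' : ℝ → ℝ) {x : E4} (hx : ‖E4.spatial x - ξ (x 0)‖ ≤ R' (x 0)) :
    Kerr.radius a (poincareInv Λ c x) ≤ (1 + 3 * |((Λ : E4 ≃L[ℝ] E4) (E4.basisVector 0)) 0|) *
      (R' (x 0) + ‖ξ (x 0) - (E4.spatial c + (x 0 - c 0) •
        ((((Λ : E4 ≃L[ℝ] E4) (E4.basisVector 0)) 0)⁻¹ •
          E4.spatial ((Λ : E4 ≃L[ℝ] E4) (E4.basisVector 0))))‖) := by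
  refine (radius_poincareInv_le_dist_line Λ c x a).trans (mul_le_mul_of_nonneg_left ?_
    (by positivity))
  exact (norm_sub_le_norm_sub_add_norm_sub _ (ξ (x 0)) _).trans (add_le_add hx le_rfl)

/-- **A Cesàro velocity makes the drift from the straight line sublinear**: if `ξ(t)/t → u` then
`‖ξ(t) − (c̲ + (t − c⁰)u)‖/t → 0` for every `c` (algebra of limits: `ξ(t)/t − c̲/t − (1 − c⁰/t)u →
u − 0 − u = 0`). [folklore] -/
theorem tendsto_drift_div_of_cesaro {ξ : ℝ → E3} {u : E3}
    (hξ : Tendsto (fun t ↦ t⁻¹ • ξ t) atTop (𝓝 u)) (c₀ : ℝ) (c : E3) :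
    Tendsto (fun t ↦ ‖ξ t - (c + (t - c₀) • u)‖ / t) atTop (𝓝 0) := by
  have h0 : Tendsto (fun r : ℝ ↦ r⁻¹) atTop (𝓝 0) := tendsto_inv_atTop_zero
  have h1 : Tendsto (fun t : ℝ ↦ t⁻¹ • c) atTop (𝓝 0) := by
    simpa using h0.smul_const c
  have h2 : Tendsto (fun t : ℝ ↦ (1 - t⁻¹ * c₀) • u) atTop (𝓝 u) := by
    have : Tendsto (fun t : ℝ ↦ 1 - t⁻¹ * c₀) atTop (𝓝 1) := by
      simpa using (h0.mul_const c₀).const_sub 1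
    simpa using this.smul_const u
  have h3 : Tendsto (fun t ↦ t⁻¹ • ξ t - t⁻¹ • c - (1 - t⁻¹ * c₀) • u) atTop (𝓝 (u - 0 - u)) :=
    (hξ.sub h1).sub h2
  rw [sub_zero, sub_self] at h3
  have h4 := h3.norm
  rw [norm_zero] at h4
  refine h4.congr' ?_
  filter_upwards [eventually_gt_atTop (0 : ℝ)] with t ht
  have hfac : t⁻¹ • ξ t - t⁻¹ • c - (1 - t⁻¹ * c₀) • u = t⁻¹ • (ξ t - (c + (t - c₀) • u)) := by
    have hsc : t⁻¹ * (t - c₀) = 1 - t⁻¹ * c₀ := by field_simp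
    rw [smul_sub, smul_add, smul_smul, hsc]
    abel
  rw [hfac, norm_smul, norm_inv, Real.norm_of_nonneg ht.le, div_eq_inv_mul]

/-- **Sublinear excision radii.** If `R′(t)/t → 0` and the drift is sublinear, the excision radius
`ρ(t) = C·(R′(t) + drift(t))` satisfies `ρ(t)/t → 0` (field `tendsto_excision_div`). [folklore] -/
theorem tendsto_excisionRadius_div {R' drift : ℝ → ℝ} (C : ℝ)
    (hR : Tendsto (fun t ↦ R' t / t) atTop (𝓝 0)) (hd : Tendsto (fun t ↦ drift t / t) atTop (𝓝 0)) :
    Tendsto (fun t ↦ C * (R' t + drift t) / t) atTop (𝓝 0) := by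
  have h := (hR.add hd).const_mul C
  rw [add_zero, mul_zero] at h
  refine h.congr fun t ↦ ?_
  ring

/-- Registered sub-goal form (stub `radius_poincareInv_le_of_near_centre` of the crux item) of
`radius_poincareInv_le_of_near_centre'`: balls about the actual centre lie in the straight tube.
[folklore] -/
theorem radius_poincareInv_le_of_near_centre : open Literature.Geometry.Lorentzian in ∀ (Λ : lorentzGroup) (c : E4) (a : ℝ) (ξ : ℝ → E3) (R' : ℝ → ℝ) {x : E4}, ‖E4.spatial x - ξ (x 0)‖ ≤ R' (x 0) → Kerr.radius a (poincareInv Λ c x) ≤ (1 + 3 * |((Λ : E4 ≃L[ℝ] E4) (E4.basisVector 0)) 0|) * (R' (x 0) + ‖ξ (x 0) - (E4.spatial c + (x 0 - c 0) • ((((Λ : E4 ≃L[ℝ] E4) (E4.basisVector 0)) 0)⁻¹ • E4.spatial ((Λ : E4 ≃L[ℝ] E4) (E4.basisVector 0))))‖) :=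
  fun Λ c a ξ R' _ hx ↦ radius_poincareInv_le_of_near_centre' Λ c a ξ R' hx

end Summit.FinalStateConjecture.FinalStateConjecture.Theorems

end
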